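import Literature.NumberTheory.EllipticCurves.BinaryLatticeKroneckerLimit
import Literature.NumberTheory.EllipticCurves.WeierstrassTransformationFive
import Literature.NumberTheory.EllipticCurves.WeierstrassAdditionProofs
import Literature.NumberTheory.EllipticCurves.LatticeInclusionRationalProofs
import Literature.NumberTheory.EllipticCurves.GaussianLatticeQuarterValues
import Mathlib.Analysis.Normed.Module.Connected
import Mathlib.Analysis.Calculus.MeanValue
import Mathlib.Analysis.Calculus.Deriv.Shift
import HarnessLib

/-!
# The distribution relation of the Eisenstein number `E₁(z; L)` under an inclusion of lattices

Topic `Literature/NumberTheory/EllipticCurves` (complex-lattice cluster); a proofs-only file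
(theorems only, no definitions, no named facts) of deliberate dot-notation extensions of Mathlib's
`PeriodPair`, continuing `BinaryLatticeKroneckerLimit.lean` (which defines
`PeriodPair.eisensteinE₁ L z = ζ(z; L) − η(z; L)`, Rubin's weight-one Eisenstein number of
LNM 1716 Def. 7.11 / Prop. 7.12, `η = L.quasiPeriodMap` the `ℝ`-linear quasi-period map).

Let `Λ ⊆ Λ'` be lattices (period pairs `L`, `L'`) and `S ∋ 0` a system of representatives of
`Λ'/Λ` (`x ∈ Λ' ↔ ∃ c ∈ S, x − c ∈ Λ`, distinct classes — the phrasing of the tree's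
`PeriodPair.weierstrassP_transformation` and `PeriodPair.exists_finset_representatives`), so
`#S = [Λ' : Λ] =: N`. We prove:

* `PeriodPair.eisensteinE₁_add_of_mem_lattice`, `…_neg`, `…_eq_of_lattice_eq`, `…_mulLeft` —
  `E₁(·; L)` is `Λ`-periodic, odd, depends only on the lattice `Λ` (not on the basis), and is
  homogeneous of degree `−1`: `E₁(cz; cΛ) = c⁻¹ E₁(z; Λ)` (Rubin: "by inspection
  `E_k(z; 𝔞⁻¹L) = ψ(𝔞)^k E_k(ψ(𝔞)z; L)`", proof of Thm. 7.17).
* `PeriodPair.quasiPeriodMap_eq_of_reps` — **the quasi-period maps of `Λ ⊆ Λ'`**: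
  `η(z; Λ') = N · η(z; Λ) + (Σ_{c ∈ S, c ≠ 0} ℘_Λ(c)) · z` for all `z ∈ ℂ`; in particular
  `N η(·; Λ) − η(·; Λ')` is `ℂ`-linear (its `z̄`-parts `π/area` cancel, `area(Λ) = N area(Λ')`),
  and in Rubin's notation `s₂(Λ') = N s₂(Λ) + Σ' ℘_Λ(c)` (the weight-two companion of the
  relation below, equivalent to the tree's transformation formula for `℘`).
* `PeriodPair.sum_eisensteinE₁_sub_eq` / `PeriodPair.sum_eisensteinE₁_add_eq` — **the
  distribution relation of weight one**: for `z ∉ Λ'`,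

    `Σ_{c ∈ S} E₁(z − c; Λ) = E₁(z; Λ') = Σ_{c ∈ S} E₁(z + c; Λ)`.

  This is the relation behind Rubin's Thm. 7.13 at `k = 1` (the logarithmic derivative of the
  elliptic function `Θ_{L,𝔞}` is `12(N𝔞 E₁(z; L) − E₁(z; 𝔞⁻¹L))`) and behind the distribution
  relation of elliptic units (Rubin Thm. 7.6; de Shalit, *Iwasawa theory of elliptic curves with
  complex multiplication*, II.2.3–2.5); Weil, *Elliptic functions according to Eisenstein and
  Kronecker*, Ch. IV, proves such "distribution" (trace) relations for Eisenstein–Kronecker series.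

Proof (a genuinely shorter road than the non-holomorphic `θ(z; L) = Δ e^{-6η(z;L)z} σ¹²` of Rubin's
Lemma 7.10, using what the tree already has). Put `G(z) = Σ_c ζ_Λ(z − c) − ζ_{Λ'}(z)` on the open
connected set `U = ℂ ∖ Λ'` (complement of a countable set). By `ζ' = −℘`
(`PeriodPair.deriv_weierstrassZeta_holds`) and the transformation of order `N`
(`PeriodPair.weierstrassP_transformation`: `℘_{Λ'}(z) = Σ_c ℘_Λ(z − c) − Σ'℘_Λ(c)`), `G' ≡ −C`,
`C = Σ' ℘_Λ(c)`, so `G(z) = −Cz + a` (`IsOpen.exists_eq_add_of_deriv_eq`). The function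
`F(z) = Σ_c E₁(z − c; Λ) − E₁(z; Λ')` differs from `G` by the `ℝ`-linear terms, is `Λ'`-periodic
(translation by `ω ∈ Λ'` permutes the classes; `E₁(·; Λ)` is `Λ`-periodic by the
quasi-periodicity `ζ(z + ω) = ζ(z) + η(ω)`, `PeriodPair.weierstrassZeta_add_period`), and
comparing `F(z₀ + ω) = F(z₀)` with the affine formula gives `η_{Λ'}(ω) = N η_Λ(ω) + Cω` on `Λ'`,
hence on `ℂ = Λ' ⊗ ℝ`; then `F` is constant on `U`, and odd, hence zero.

## References

* K. Rubin, *Elliptic curves with complex multiplication and the conjecture of Birch and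
  Swinnerton-Dyer*, in: Arithmetic Theory of Elliptic Curves (Cetraro 1997), LNM 1716, Springer
  1999, §7.4: Def. 7.9, Def. 7.11, Prop. 7.12, Thm. 7.13 (held:
  `book:coates1999-arithmetic-theory-elliptic-curves`, p. 244). [Rubin1999]
* E. de Shalit, *Iwasawa Theory of Elliptic Curves with Complex Multiplication*, Perspectives in
  Math. 3, Academic Press 1987, II.2 (distribution relations). [deShalit1987]
* A. Weil, *Elliptic Functions according to Eisenstein and Kronecker*, Springer 1976, Ch. IV, VIII.
* D. F. Lawden, *Elliptic Functions and Applications*, Springer 1989, §9.8 (transformation of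
  order `n`). [Lawden1989]
* J. H. Silverman, *Advanced Topics in the Arithmetic of Elliptic Curves*, GTM 151, Springer 1994,
  Prop. VI.3.1 (the `ℝ`-linear quasi-period map). [Silverman1994]
-/

noncomputable section

open Complex Set Filter Topology
open Literature.NumberTheory.EllipticCurves.GaussianLattice (weierstrassZeta_eq_of_lattice_eq)

namespace PeriodPair

variable {L L' : PeriodPair}

/-! ### Quasi-periodicity of `ζ` and periodicity of `E₁` under the whole lattice -/

/-- **`ζ(z + ω) = ζ(z) + η(ω)` for every `ω ∈ Λ`** (and every `z`, junk values included), with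
`η = L.quasiPeriodMap`: write `ω = mω₁ + nω₂` and use `ζ(z + mω₁ + nω₂) = ζ(z) + mη₁ + nη₂`
(`PeriodPair.weierstrassZeta_add_period`, Whittaker–Watson §20.41) and `η(mω₁ + nω₂) = mη₁ + nη₂`.
[cite: WhittakerWatson1927, §20.41] -/
theorem weierstrassZeta_add_of_mem_lattice (L : PeriodPair) {ω : ℂ} (hω : ω ∈ L.lattice)
    (z : ℂ) : L.weierstrassZeta (z + ω) = L.weierstrassZeta z + L.quasiPeriodMap ω := by
  obtain ⟨m, n, rfl⟩ := PeriodPair.mem_lattice.mp hω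
  rw [L.weierstrassZeta_add_period]
  have h := L.quasiPeriodMap_smul_add_smul (m : ℝ) (n : ℝ)
  simp only [Complex.ofReal_intCast] at h
  rw [h]

/-- **`E₁(·; L)` is `Λ`-periodic**: `E₁(z + ω; L) = E₁(z; L)` for `ω ∈ Λ` (the quasi-period of
`ζ` is exactly cancelled by the `ℝ`-linear correction `η`; Rubin, LNM 1716, §7.4: `E₁(z; L)` is a
function on `ℂ/L`). [cite: Rubin1999, §7.4 Def. 7.11] -/
theorem eisensteinE₁_add_of_mem_lattice (L : PeriodPair) {ω : ℂ} (hω : ω ∈ L.lattice) (z : ℂ) :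
    L.eisensteinE₁ (z + ω) = L.eisensteinE₁ z := by
  rw [eisensteinE₁_def, eisensteinE₁_def, L.weierstrassZeta_add_of_mem_lattice hω, map_add]
  ring

/-- `E₁(z − ω; L) = E₁(z; L)` for `ω ∈ Λ`. [cite: Rubin1999, §7.4 Def. 7.11] -/
theorem eisensteinE₁_sub_of_mem_lattice (L : PeriodPair) {ω : ℂ} (hω : ω ∈ L.lattice) (z : ℂ) :
    L.eisensteinE₁ (z - ω) = L.eisensteinE₁ z := by
  rw [sub_eq_add_neg, L.eisensteinE₁_add_of_mem_lattice (L.lattice.neg_mem hω)]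

/-- **`E₁(·; L)` is odd**: `E₁(−z; L) = −E₁(z; L)` (`ζ` and `η` are odd). [folklore] -/
theorem eisensteinE₁_neg (L : PeriodPair) (z : ℂ) : L.eisensteinE₁ (-z) = -L.eisensteinE₁ z := by
  rw [eisensteinE₁_def, eisensteinE₁_def, L.weierstrassZeta_neg, L.quasiPeriodMap_neg]
  ring

/-- **`E₁` vanishes at the points of order dividing `2`**: if `2w ∈ Λ` then `E₁(w; L) = 0`
(`E₁` is odd and `Λ`-periodic: `E₁(w) = E₁(w − 2w) = E₁(−w) = −E₁(w)`); in particular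
`E₁(ω; L) = 0` for `ω ∈ Λ` (where the value is a junk value) and at the three half-periods.
[cite: Rubin1999, §7.4 Def. 7.11] -/
theorem eisensteinE₁_eq_zero_of_two_mul_mem_lattice (L : PeriodPair) {w : ℂ}
    (hw : 2 * w ∈ L.lattice) : L.eisensteinE₁ w = 0 := by
  have h1 := L.eisensteinE₁_sub_of_mem_lattice hw w
  rw [show w - 2 * w = -w by ring, L.eisensteinE₁_neg] at h1
  linear_combination -h1 / 2

/-- `E₁(ω; L) = 0` for `ω ∈ Λ` (junk value at the poles, pinned down by quasi-periodicity).
[cite: Rubin1999, §7.4 Def. 7.11] -/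
theorem eisensteinE₁_eq_zero_of_mem_lattice (L : PeriodPair) {ω : ℂ} (hω : ω ∈ L.lattice) :
    L.eisensteinE₁ ω = 0 :=
  L.eisensteinE₁_eq_zero_of_two_mul_mem_lattice (by simpa [two_mul] using add_mem hω hω)

/-- `ζ` has derivative `−℘` off the lattice, in `HasDerivAt` form (from the tree's
`differentiableOn_weierstrassZeta_holds` and `deriv_weierstrassZeta_holds`; Whittaker–Watson
§20.4). [cite: WhittakerWatson1927, §20.4] -/
theorem hasDerivAt_weierstrassZeta_of_notMem (L : PeriodPair) {w : ℂ} (hw : w ∉ L.lattice) :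
    HasDerivAt L.weierstrassZeta (-℘[L] w) w := by
  have hU : IsOpen (L.lattice : Set ℂ)ᶜ := L.isClosed_lattice.isOpen_compl
  have hd := (L.differentiableOn_weierstrassZeta_holds.differentiableAt (hU.mem_nhds hw)).hasDerivAt
  rwa [L.deriv_weierstrassZeta_holds w hw] at hd

/-! ### `E₁` depends only on the lattice and is homogeneous of degree `−1` -/

/-- **The quasi-period map depends only on the lattice** (not on the chosen basis): if
`Λ(L) = Λ(L')` then `η_L = η_{L'}` — both are `ℝ`-linear and `η(ω) = ζ(z + ω) − ζ(z)` on the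
common lattice, which spans `ℂ` over `ℝ`. [cite: Silverman1994, Prop VI.3.1] -/
theorem quasiPeriodMap_eq_of_lattice_eq (h : L.lattice = L'.lattice) :
    L.quasiPeriodMap = L'.quasiPeriodMap := by
  have key : ∀ ω ∈ L.lattice, L.quasiPeriodMap ω = L'.quasiPeriodMap ω := by
    intro ω hω
    have h1 := L.weierstrassZeta_add_of_mem_lattice hω (L.ω₁ / 2)
    have h2 := L'.weierstrassZeta_add_of_mem_lattice (h ▸ hω) (L.ω₁ / 2)
    rw [weierstrassZeta_eq_of_lattice_eq h] at h1
    linear_combination -h1 + h2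
  refine L.basis.ext fun i ↦ ?_
  fin_cases i
  · simpa using key _ L.ω₁_mem_lattice
  · simpa using key _ L.ω₂_mem_lattice

/-- **`E₁(·; L)` depends only on the lattice `Λ(L)`.** [cite: Rubin1999, §7.4 Def. 7.11] -/
theorem eisensteinE₁_eq_of_lattice_eq (h : L.lattice = L'.lattice) :
    L.eisensteinE₁ = L'.eisensteinE₁ := by
  ext z
  rw [eisensteinE₁_def, eisensteinE₁_def, weierstrassZeta_eq_of_lattice_eq h,
    quasiPeriodMap_eq_of_lattice_eq h]

/-- **Homogeneity of degree `−1`**: `E₁(cz; cΛ) = c⁻¹ E₁(z; Λ)` for `c ≠ 0` (from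
`ζ(cz; cΛ) = c⁻¹ζ(z; Λ)` and `η_{cΛ}(cz) = c⁻¹η_Λ(z)`, the tree's `weierstrassZeta_mulLeft`,
`quasiPeriodMap_mulLeft`). Rubin uses it as "`E_k(z; 𝔞⁻¹L) = ψ(𝔞)^k E_k(ψ(𝔞)z; L)`".
[cite: Rubin1999, §7.4 proof of Thm. 7.17] -/
theorem eisensteinE₁_mulLeft (L : PeriodPair) {c : ℂ} (hc : c ≠ 0) (z : ℂ) :
    (L.mulLeft c hc).eisensteinE₁ (c * z) = c⁻¹ * L.eisensteinE₁ z := by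
  rw [eisensteinE₁_def, eisensteinE₁_def, L.weierstrassZeta_mulLeft hc, L.quasiPeriodMap_mulLeft hc]
  ring

/-- Homogeneity, division form: `E₁(z; cΛ) = c⁻¹ E₁(z/c; Λ)`. [cite: Rubin1999, §7.4 proof of Thm. 7.17] -/
theorem eisensteinE₁_mulLeft' (L : PeriodPair) {c : ℂ} (hc : c ≠ 0) (z : ℂ) :
    (L.mulLeft c hc).eisensteinE₁ z = c⁻¹ * L.eisensteinE₁ (z / c) := by
  rw [← L.eisensteinE₁_mulLeft hc (z / c), mul_div_cancel₀ z hc]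

/-! ### Sums over a system of representatives of `Λ'/Λ` -/

section Reps

variable {S : Finset ℂ}

/-- **Translation by `t ∈ Λ'` permutes the classes of `Λ'/Λ`**: for a `Λ`-periodic `f` and a
system of representatives `S`, `Σ_{c ∈ S} f(c + t) = Σ_{c ∈ S} f(c)`. [folklore] -/
theorem sum_reps_add_eq (hS : ∀ x, x ∈ L'.lattice ↔ ∃ c ∈ S, x - c ∈ L.lattice)
    (hSd : ∀ c ∈ S, ∀ c' ∈ S, c - c' ∈ L.lattice → c = c') {t : ℂ} (ht : t ∈ L'.lattice)
    {f : ℂ → ℂ} (hf : ∀ x, ∀ l ∈ L.lattice, f (x + l) = f x) :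
    ∑ c ∈ S, f (c + t) = ∑ c ∈ S, f c := by
  have hex : ∀ c ∈ S, ∃ c' ∈ S, (c + t) - c' ∈ L.lattice := fun c hc ↦
    (hS (c + t)).mp (add_mem (mem_of_mem_reps hS hc) ht)
  refine Finset.sum_bij (fun c hc ↦ Classical.choose (hex c hc))
    (fun c hc ↦ (Classical.choose_spec (hex c hc)).1) ?_ ?_ ?_
  · intro c₁ hc₁ c₂ hc₂ heq
    have h1 := (Classical.choose_spec (hex c₁ hc₁)).2
    have h2 := (Classical.choose_spec (hex c₂ hc₂)).2
    rw [heq] at h1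
    refine hSd c₁ hc₁ c₂ hc₂ ?_
    have e : c₁ - c₂ = (c₁ + t - Classical.choose (hex c₂ hc₂)) -
        (c₂ + t - Classical.choose (hex c₂ hc₂)) := by ring
    rw [e]
    exact sub_mem h1 h2
  · intro b hb
    obtain ⟨a, ha, hab⟩ := (hS (b - t)).mp (sub_mem (mem_of_mem_reps hS hb) ht)
    refine ⟨a, ha, ?_⟩
    have hspec := Classical.choose_spec (hex a ha)
    refine reps_unique hSd hspec.1 hb hspec.2 ?_
    have e : a + t - b = -((b - t) - a) := by ring
    rw [e]
    exact neg_mem hab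
  · intro c hc
    have hspec := Classical.choose_spec (hex c hc)
    calc f (c + t) = f (Classical.choose (hex c hc) + ((c + t) - Classical.choose (hex c hc))) := by
          congr 1; ring
      _ = f (Classical.choose (hex c hc)) := hf _ _ hspec.2

/-- **Negation permutes the classes of `Λ'/Λ`**: for a `Λ`-periodic `f` and a system of
representatives `S`, `Σ_{c ∈ S} f(−c) = Σ_{c ∈ S} f(c)`. [folklore] -/
theorem sum_reps_neg_eq (hS : ∀ x, x ∈ L'.lattice ↔ ∃ c ∈ S, x - c ∈ L.lattice)
    (hSd : ∀ c ∈ S, ∀ c' ∈ S, c - c' ∈ L.lattice → c = c')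
    {f : ℂ → ℂ} (hf : ∀ x, ∀ l ∈ L.lattice, f (x + l) = f x) :
    ∑ c ∈ S, f (-c) = ∑ c ∈ S, f c := by
  have hex : ∀ c ∈ S, ∃ c' ∈ S, (-c) - c' ∈ L.lattice := fun c hc ↦
    (hS (-c)).mp (neg_mem (mem_of_mem_reps hS hc))
  refine Finset.sum_bij (fun c hc ↦ Classical.choose (hex c hc))
    (fun c hc ↦ (Classical.choose_spec (hex c hc)).1) ?_ ?_ ?_
  · intro c₁ hc₁ c₂ hc₂ heq
    have h1 := (Classical.choose_spec (hex c₁ hc₁)).2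
    have h2 := (Classical.choose_spec (hex c₂ hc₂)).2
    rw [heq] at h1
    refine hSd c₁ hc₁ c₂ hc₂ ?_
    have e : c₁ - c₂ = (-c₂ - Classical.choose (hex c₂ hc₂)) -
        (-c₁ - Classical.choose (hex c₂ hc₂)) := by ring
    rw [e]
    exact sub_mem h2 h1
  · intro b hb
    obtain ⟨a, ha, hab⟩ := (hS (-b)).mp (neg_mem (mem_of_mem_reps hS hb))
    refine ⟨a, ha, ?_⟩
    have hspec := Classical.choose_spec (hex a ha)
    refine reps_unique hSd hspec.1 hb hspec.2 ?_
    have e : -a - b = -b - a := by ring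
    rw [e]
    exact hab
  · intro c hc
    have hspec := Classical.choose_spec (hex c hc)
    calc f (-c) = f (Classical.choose (hex c hc) + ((-c) - Classical.choose (hex c hc))) := by
          congr 1; ring
      _ = f (Classical.choose (hex c hc)) := hf _ _ hspec.2

/-- `Σ_{c ∈ S} E₁(z + t − c; Λ) = Σ_{c ∈ S} E₁(z − c; Λ)` for `t ∈ Λ'`: the class sum of `E₁(·; Λ)`
is `Λ'`-periodic. [folklore] -/
theorem sum_eisensteinE₁_sub_add_of_mem (hS : ∀ x, x ∈ L'.lattice ↔ ∃ c ∈ S, x - c ∈ L.lattice)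
    (hSd : ∀ c ∈ S, ∀ c' ∈ S, c - c' ∈ L.lattice → c = c') {t : ℂ} (ht : t ∈ L'.lattice)
    (z : ℂ) :
    ∑ c ∈ S, L.eisensteinE₁ (z + t - c) = ∑ c ∈ S, L.eisensteinE₁ (z - c) := by
  have hf : ∀ x, ∀ l ∈ L.lattice, L.eisensteinE₁ (z - (x + l)) = L.eisensteinE₁ (z - x) := by
    intro x l hl
    rw [show z - (x + l) = (z - x) - l by ring, L.eisensteinE₁_sub_of_mem_lattice hl]
  have h := sum_reps_add_eq (f := fun c ↦ L.eisensteinE₁ (z - c)) hS hSd (L'.lattice.neg_mem ht) hf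
  beta_reduce at h
  rw [← h]
  refine Finset.sum_congr rfl fun c _ ↦ ?_
  congr 1
  ring

/-- `Σ_{c ∈ S} E₁(z + c; Λ) = Σ_{c ∈ S} E₁(z − c; Λ)`: negation permutes the classes. [folklore] -/
theorem sum_eisensteinE₁_add_eq_sum_sub (hS : ∀ x, x ∈ L'.lattice ↔ ∃ c ∈ S, x - c ∈ L.lattice)
    (hSd : ∀ c ∈ S, ∀ c' ∈ S, c - c' ∈ L.lattice → c = c') (z : ℂ) :
    ∑ c ∈ S, L.eisensteinE₁ (z + c) = ∑ c ∈ S, L.eisensteinE₁ (z - c) := by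
  have hf : ∀ x, ∀ l ∈ L.lattice, L.eisensteinE₁ (z - (x + l)) = L.eisensteinE₁ (z - x) := by
    intro x l hl
    rw [show z - (x + l) = (z - x) - l by ring, L.eisensteinE₁_sub_of_mem_lattice hl]
  have h := sum_reps_neg_eq (f := fun c ↦ L.eisensteinE₁ (z - c)) hS hSd hf
  beta_reduce at h
  simpa only [sub_neg_eq_add] using h

/-! ### The affine identity for `Σ_c ζ_Λ(z − c) − ζ_{Λ'}(z)` -/

/-- **`Σ_{c ∈ S} ζ_Λ(z − c) − ζ_{Λ'}(z)` is affine off `Λ'`**: there is a constant `a` with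
`Σ_c ζ_Λ(z − c) − ζ_{Λ'}(z) = −(Σ_{c ≠ 0} ℘_Λ(c)) z + a` for all `z ∉ Λ'` — its derivative is
`−Σ_c ℘_Λ(z − c) + ℘_{Λ'}(z) = −Σ' ℘_Λ(c)` by the transformation of order `N`
(`PeriodPair.weierstrassP_transformation`, Lawden §9.8), and `ℂ ∖ Λ'` is open and connected.
[cite: Lawden1989, §9.8] -/
theorem exists_sum_weierstrassZeta_sub_eq_affine
    (hS : ∀ x, x ∈ L'.lattice ↔ ∃ c ∈ S, x - c ∈ L.lattice) (hS0 : (0 : ℂ) ∈ S)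
    (hSd : ∀ c ∈ S, ∀ c' ∈ S, c - c' ∈ L.lattice → c = c') :
    ∃ a : ℂ, ∀ z : ℂ, z ∉ L'.lattice →
      ∑ c ∈ S, L.weierstrassZeta (z - c) - L'.weierstrassZeta z =
        -(∑ c ∈ S.erase 0, ℘[L] c) * z + a := by
  set C : ℂ := ∑ c ∈ S.erase 0, ℘[L] c with hC
  set U : Set ℂ := (L'.lattice : Set ℂ)ᶜ with hU
  have hUo : IsOpen U := L'.isClosed_lattice.isOpen_compl
  have hcount : (L'.lattice : Set ℂ).Countable :=
    countable_of_Lindelof_of_discrete (X := L'.lattice)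
  have hUc : IsPreconnected U :=
    (hcount.isPathConnected_compl_of_one_lt_rank
      (by simp [Complex.rank_real_complex])).isConnected.isPreconnected
  set G : ℂ → ℂ := fun z ↦ ∑ c ∈ S, L.weierstrassZeta (z - c) - L'.weierstrassZeta z with hG
  -- derivative of `G` off `Λ'`
  have hGd : ∀ z ∈ U, HasDerivAt G (-C) z := by
    intro z hz
    have hz : z ∉ L'.lattice := hz
    have h1 : HasDerivAt (fun w ↦ ∑ c ∈ S, L.weierstrassZeta (w - c))
        (∑ c ∈ S, -℘[L] (z - c)) z := by
      refine HasDerivAt.fun_sum fun c hc ↦ ?_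
      exact HasDerivAt.comp_sub_const z c
        (L.hasDerivAt_weierstrassZeta_of_notMem (sub_notMem_of_notMem_of_reps hS hz hc))
    have h2 := L'.hasDerivAt_weierstrassZeta_of_notMem hz
    have h3 := h1.sub h2
    have hval : ∑ c ∈ S, -℘[L] (z - c) - -℘[L'] z = -C := by
      rw [weierstrassP_transformation hS hS0 hSd hz, Finset.sum_neg_distrib, hC]
      ring
    rw [hval] at h3
    exact h3
  have hGdiff : DifferentiableOn ℂ G U := fun z hz ↦ (hGd z hz).differentiableAt.differentiableWithinAt
  have hg : ∀ z, HasDerivAt (fun w : ℂ ↦ -C * w) (-C) z := by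
    intro z
    simpa using (hasDerivAt_id z).const_mul (-C)
  have hgdiff : DifferentiableOn ℂ (fun w : ℂ ↦ -C * w) U :=
    fun z _ ↦ (hg z).differentiableAt.differentiableWithinAt
  have hderiv : U.EqOn (deriv G) (deriv fun w : ℂ ↦ -C * w) := by
    intro z hz
    rw [(hGd z hz).deriv, (hg z).deriv]
  obtain ⟨a, ha⟩ := hUo.exists_eq_add_of_deriv_eq hUc hGdiff hgdiff hderiv
  refine ⟨a, fun z hz ↦ ?_⟩
  have := ha hz
  simpa [hG] using this

/-! ### The quasi-period maps of `Λ ⊆ Λ'` -/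

/-- **The quasi-period maps of nested lattices.** If `S ∋ 0` is a system of representatives of
`Λ'/Λ` (`N = #S = [Λ' : Λ]`), then for every `z ∈ ℂ`,

  `η(z; Λ') = N · η(z; Λ) + (Σ_{c ∈ S, c ≠ 0} ℘_Λ(c)) · z`,

`η = quasiPeriodMap` the `ℝ`-linear quasi-period map (`= s₂ z + A⁻¹ z̄`, Rubin Def. 7.9); so
`s₂(Λ') = N s₂(Λ) + Σ' ℘_Λ(c)` and `A(Λ')⁻¹ = N A(Λ)⁻¹`. Obtained by comparing the affine identity
`exists_sum_weierstrassZeta_sub_eq_affine` at `z₀` and `z₀ + ω` (`ω ∈ Λ'`) with the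
`Λ'`-periodicity of the class sum of `E₁(·; Λ)`, then extending from `Λ'` `ℝ`-linearly.
[cite: Rubin1999, §7.4 Def. 7.9 and Prop. 7.12] [cite: Lawden1989, §9.8] -/
theorem quasiPeriodMap_eq_of_reps (hS : ∀ x, x ∈ L'.lattice ↔ ∃ c ∈ S, x - c ∈ L.lattice)
    (hS0 : (0 : ℂ) ∈ S) (hSd : ∀ c ∈ S, ∀ c' ∈ S, c - c' ∈ L.lattice → c = c') (z : ℂ) :
    L'.quasiPeriodMap z =
      (S.card : ℂ) * L.quasiPeriodMap z + (∑ c ∈ S.erase 0, ℘[L] c) * z := by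
  set C : ℂ := ∑ c ∈ S.erase 0, ℘[L] c with hC
  obtain ⟨a, ha⟩ := exists_sum_weierstrassZeta_sub_eq_affine hS hS0 hSd
  -- the class sum of `E₁` minus `E₁(·; Λ')`, expanded
  have hF : ∀ x : ℂ, x ∉ L'.lattice →
      ∑ c ∈ S, L.eisensteinE₁ (x - c) - L'.eisensteinE₁ x =
        a + ∑ c ∈ S, L.quasiPeriodMap c +
          (L'.quasiPeriodMap x - (S.card : ℂ) * L.quasiPeriodMap x - C * x) := by
    intro x hx
    have h1 := ha x hx
    simp only [eisensteinE₁_def, map_sub, Finset.sum_sub_distrib, Finset.sum_const,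
      nsmul_eq_mul]
    linear_combination h1
  -- periodicity under `ω ∈ Λ'`
  have hlin : ∀ ω : ℂ, ω ∈ L'.lattice →
      L'.quasiPeriodMap ω = (S.card : ℂ) * L.quasiPeriodMap ω + C * ω := by
    intro ω hω
    set z₀ : ℂ := L'.ω₁ / 2 with hz₀
    have hz₀ : z₀ ∉ L'.lattice := L'.ω₁_div_two_notMem_lattice
    have hz₁ : z₀ + ω ∉ L'.lattice := fun h ↦ hz₀ (by simpa using sub_mem h hω)
    have hper : ∑ c ∈ S, L.eisensteinE₁ (z₀ + ω - c) - L'.eisensteinE₁ (z₀ + ω) =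
        ∑ c ∈ S, L.eisensteinE₁ (z₀ - c) - L'.eisensteinE₁ z₀ := by
      rw [sum_eisensteinE₁_sub_add_of_mem hS hSd hω, L'.eisensteinE₁_add_of_mem_lattice hω]
    rw [hF _ hz₁, hF _ hz₀, map_add, map_add] at hper
    linear_combination hper
  -- extend `ℝ`-linearly from the basis `(ω₁', ω₂')` of `ℂ`
  have hmaps : L'.quasiPeriodMap =
      (S.card : ℂ) • L.quasiPeriodMap + C • (LinearMap.id : ℂ →ₗ[ℝ] ℂ) := by
    refine L'.basis.ext fun i ↦ ?_
    fin_cases i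
    · simpa using hlin L'.ω₁ L'.ω₁_mem_lattice
    · simpa using hlin L'.ω₂ L'.ω₂_mem_lattice
  have := congrArg (fun f : ℂ →ₗ[ℝ] ℂ ↦ f z) hmaps
  simpa using this

/-! ### The distribution relation of weight one -/

/-- **Distribution relation for `E₁` (Rubin, LNM 1716, the identity behind Thm. 7.13 at `k = 1`;
de Shalit II.2).** Let `Λ ⊆ Λ'` be lattices and `S ∋ 0` a system of representatives of `Λ'/Λ`.
Then for every `z ∉ Λ'`,

  `Σ_{c ∈ S} E₁(z − c; Λ) = E₁(z; Λ')`,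

with `E₁(z; L) = ζ(z; L) − η(z; L)` (`PeriodPair.eisensteinE₁`). Proof: by
`exists_sum_weierstrassZeta_sub_eq_affine` and `quasiPeriodMap_eq_of_reps` the difference of the
two sides is constant off `Λ'`; it is odd (negation permutes the classes), hence zero.
[cite: Rubin1999, §7.4 Thm. 7.13] [cite: deShalit1987, II.2] -/
theorem sum_eisensteinE₁_sub_eq (hS : ∀ x, x ∈ L'.lattice ↔ ∃ c ∈ S, x - c ∈ L.lattice)
    (hS0 : (0 : ℂ) ∈ S) (hSd : ∀ c ∈ S, ∀ c' ∈ S, c - c' ∈ L.lattice → c = c') {z : ℂ}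
    (hz : z ∉ L'.lattice) :
    ∑ c ∈ S, L.eisensteinE₁ (z - c) = L'.eisensteinE₁ z := by
  set C : ℂ := ∑ c ∈ S.erase 0, ℘[L] c with hC
  obtain ⟨a, ha⟩ := exists_sum_weierstrassZeta_sub_eq_affine hS hS0 hSd
  -- the difference is the constant `a + Σ_c η_Λ(c)` off `Λ'`
  have hF : ∀ x : ℂ, x ∉ L'.lattice →
      ∑ c ∈ S, L.eisensteinE₁ (x - c) - L'.eisensteinE₁ x = a + ∑ c ∈ S, L.quasiPeriodMap c := by
    intro x hx
    have h1 := ha x hx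
    have h2 := quasiPeriodMap_eq_of_reps hS hS0 hSd x
    simp only [eisensteinE₁_def, map_sub, Finset.sum_sub_distrib, Finset.sum_const,
      nsmul_eq_mul]
    linear_combination h1 + h2
  -- oddness at the base point `ω₁'/2`
  set z₀ : ℂ := L'.ω₁ / 2 with hz₀
  have hz₀ : z₀ ∉ L'.lattice := L'.ω₁_div_two_notMem_lattice
  have hz₀' : -z₀ ∉ L'.lattice := fun h ↦ hz₀ (by simpa using neg_mem h)
  have hodd : ∑ c ∈ S, L.eisensteinE₁ (-z₀ - c) - L'.eisensteinE₁ (-z₀) =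
      -(∑ c ∈ S, L.eisensteinE₁ (z₀ - c) - L'.eisensteinE₁ z₀) := by
    rw [← sum_eisensteinE₁_add_eq_sum_sub hS hSd z₀, L'.eisensteinE₁_neg, neg_sub',
      ← Finset.sum_neg_distrib]
    congr 1
    refine Finset.sum_congr rfl fun c _ ↦ ?_
    rw [show -z₀ - c = -(z₀ + c) by ring, L.eisensteinE₁_neg]
  rw [hF _ hz₀', hF _ hz₀] at hodd
  have hconst : a + ∑ c ∈ S, L.quasiPeriodMap c = 0 := by linear_combination hodd / 2
  have := hF z hz
  rw [hconst] at this
  exact sub_eq_zero.mp this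

/-- **Distribution relation for `E₁`, `z + c` form**: for `z ∉ Λ'`,
`Σ_{c ∈ S} E₁(z + c; Λ) = E₁(z; Λ')` (Rubin Thm. 7.13 at `k = 1` sums `E₁` over
`u ∈ 𝔞⁻¹L/L`). [cite: Rubin1999, §7.4 Thm. 7.13] -/
theorem sum_eisensteinE₁_add_eq (hS : ∀ x, x ∈ L'.lattice ↔ ∃ c ∈ S, x - c ∈ L.lattice)
    (hS0 : (0 : ℂ) ∈ S) (hSd : ∀ c ∈ S, ∀ c' ∈ S, c - c' ∈ L.lattice → c = c') {z : ℂ}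
    (hz : z ∉ L'.lattice) :
    ∑ c ∈ S, L.eisensteinE₁ (z + c) = L'.eisensteinE₁ z := by
  rw [sum_eisensteinE₁_add_eq_sum_sub hS hSd, sum_eisensteinE₁_sub_eq hS hS0 hSd hz]

/-- **Distribution relation, intrinsic form**: for lattices `Λ ⊆ Λ'` there is a finite system of
representatives `S ∋ 0` of `Λ'/Λ` inside `Λ'` (`PeriodPair.exists_finset_representatives`), and
for any such `S`, `Σ_{c ∈ S} E₁(z + c; Λ) = E₁(z; Λ')` off `Λ'`. [cite: Rubin1999, §7.4 Thm. 7.13] -/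
theorem exists_reps_sum_eisensteinE₁_add_eq (h : L.lattice ≤ L'.lattice) :
    ∃ S : Finset ℂ, (0 : ℂ) ∈ S ∧ (↑S ⊆ (L'.lattice : Set ℂ)) ∧
      (∀ x, x ∈ L'.lattice ↔ ∃ c ∈ S, x - c ∈ L.lattice) ∧
      (∀ c ∈ S, ∀ c' ∈ S, c - c' ∈ L.lattice → c = c') ∧
      ∀ z : ℂ, z ∉ L'.lattice → ∑ c ∈ S, L.eisensteinE₁ (z + c) = L'.eisensteinE₁ z := by
  obtain ⟨S, hS0, hSsub, hS, hSd⟩ := exists_finset_representatives L L' h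
  exact ⟨S, hS0, hSsub, hS, hSd, fun z hz ↦ sum_eisensteinE₁_add_eq hS hS0 hSd hz⟩

end Reps

end PeriodPair

end
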